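import Literature.AlgebraicGeometry.Morphisms.CechUnitCocycleResidueFaceClass
import HarnessLib

/-!
# The residue difference class of two lifts, for a FLAT family with an AFFINE cover: the heads of
# `CechUnitCocycle{SmallExtensionResidue, ResidueFibreClass, ResidueFaceClass}` with flatness only on the cover
# (Görtz–Wedhorn II, Lemma 26.15 / Lemma 24.72 Step (I); Hartshorne DT Thm. 6.4 (b))

Layer `Literature/AlgebraicGeometry/Morphisms`, namespace `Literature.AlgebraicGeometry.Morphisms.CechUnitCocycle`.
THEOREMS ONLY (no definition, no named fact, no instance, no notation).  Cell `hodgecm-mathlib` (D-0151), F-2d road (R-def)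
«theorem of the cube over a non-reduced base by Artinian induction», Step (I) brick Č1′ (author B-p07 (g16)).

★ Č1 `CechUnitCocycleSmallExtensionResidue`, ★ Č2 `CechUnitCocycleResidueFibreClass` and ★ Č3 `CechUnitCocycleResidueFaceClass`
(B-p07 (g15)) state their flatness hypothesis as the blanket instance `[∀ V : X.Opens, Module.Flat A (Sections f V)]` — «`Γ(V, 𝒪_X)`
is `A`-flat for EVERY open `V`».  That holds when `A` is a field (the M13 N3 setting), but NOT for a non-constant flat family
`f : X → Spec A` (e.g. a first-order deformation of `E₀ × E₀` over `k[ε]` and `V = (E₀ ∖ 0) × E₀`: the lifting obstruction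
`s ↦ ⟨θ, ds⟩` makes `Γ(V, 𝒪_X)` non-flat), which is exactly the setting of [GortzWedhorn2023] Lemma 24.72 over a general base.  The
proofs only use flatness of `Γ(U_i ∩ U_j)` and `Γ(U_i ∩ U_j ∩ U_l)` (★ `kerMap_sections_injective`), and for `X/A` flat these ARE
flat as soon as those opens are affine (an affine open `V` is flat over `Spec A` iff `Γ(V)` is a flat `A`-module).  This file
re-cuts the seven flat-dependent heads of the chain under the dischargeable hypotheses

  `hfl : ∀ V : X.Opens, IsAffineOpen V → Module.Flat A (Sections f V)` («affine opens have flat sections»),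
  `hU2 : ∀ i j, IsAffineOpen (U i ⊓ U j)`, `hU3 : ∀ i j l, IsAffineOpen (U i ⊓ U j ⊓ U l)`

(and the same for a face `Y`), with the ★ proofs verbatim after `haveI`; everything flatness-free (the kernel-map calculus,
`exists_rel_of_diffCochainK_eq_cechD0`, `exists_twist_sameRed'`, the fibre dictionary `bcSections_comm_*`, the restriction
calculus `comapR_*`, `exists_ucocycle_comap`, `diffCochainK_comap`, `comap_bcSections_comm`, `fibreClass_congr_eq_zero_iff`) is
consumed from ★ as it stands.

* §1 `exists_diffCochainK` (∃ form of ★ `existsUnique_diffCochainK`), `diffCochainK_unique`, **`diffCochainK_cocycle_of_isAffineOpen`**,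
  **`exists_eq_cechD0_of_rel_of_isAffineOpen`**;
* §2 **`fibreCochain_mem_cechZ1`**, **`exists_rel_of_fibreClass_eq_zero_of_isAffineOpen`**, **`fibreClass_eq_zero_of_rel_of_isAffineOpen`**;
* §3 **`cechComapH1_fibreClass_eq_zero_of_rel_comap_of_isAffineOpen`** — THE FACE STEP.

HC_CM is proved only modulo the 7 printed citations until rung 0 closes; nothing here is about HC.

## References
* [GortzWedhorn2023] U. Görtz, T. Wedhorn, *Algebraic Geometry II* (2023), Lemma 26.15, Lemma 24.72 proof Step (I) (p. 409).
* [Hartshorne2010] R. Hartshorne, *Deformation Theory*, GTM 257 (2010), §6 Thm. 6.4 (b) and proof (pp. 50–51).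
* [StacksProject] The Stacks Project, Tag 00HL (flatness), Tag 02KH (degree `0`), Tag 01ED (Čech cohomology).
-/

noncomputable section

universe u v

open TensorProduct CategoryTheory AlgebraicGeometry
open Literature.RingTheory.Flat Literature.RingTheory.Flat.IsSmallExtension

namespace Literature.AlgebraicGeometry.Morphisms

namespace CechUnitCocycle

variable {A : Type u} [CommRing A] {X : Scheme.{u}} {f : X ⟶ Spec (.of A)} {ι : Type v} {U : ι → X.Opens}
variable {R R₀ k : Type u} [CommRing R] [CommRing R₀] [CommRing k] [Algebra A R] [Algebra A R₀] [Algebra A k]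
  {π : R →ₐ[A] R₀} {ρ : R →ₐ[A] k} {I : Ideal R} {d : ℕ} {e : (Fin d → k) ≃ₗ[A] I}
  (H : IsSmallExtension π ρ I e) {ρ₀ : R₀ →ₐ[A] k} (hρ : ρ₀.comp π = ρ)
  (hfl : ∀ V : X.Opens, IsAffineOpen V → Module.Flat A (Sections f V))

/-- `g⁻¹U_i ∩ g⁻¹U_j ⊆ g⁻¹(U_i ∩ U_j)` (private plumbing). [folklore] -/
private theorem pre2 {Z : Scheme.{u}} (g : Z ⟶ X) (U : ι → X.Opens) (i j : ι) :
    preimageFamily g U i ⊓ preimageFamily g U j ≤ g ⁻¹ᵁ (U i ⊓ U j) :=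
  fun _ hx => hx

/-! ## §1 The difference cochain with flatness on the cover only -/

section Diff

include H in
/-- Two units of `Γ(V) ⊗_A R` with the same reduction differ by `1 + κ y` for a unique `y`, `Γ(V)` flat (★ `existsUnique_diffK`
with the flatness hypothesis on `V` alone; private re-proof). [cite: GortzWedhorn2023, Lemma 26.15] -/
private theorem existsUnique_diffK_flat {V : X.Opens} [Module.Flat A (Sections f V)] {x x' : Sections f V ⊗[A] R}
    (hx : IsUnit x) (hred : coef f π V x' = coef f π V x) :
    ∃! y : Fin d → Sections f V ⊗[A] k, x' = x * (1 + kerMap e (Sections f V) y) := by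
  set xi : Sections f V ⊗[A] R := ↑hx.unit⁻¹ with hxi
  have hxi1 : xi * x = 1 := hx.val_inv_mul
  have hxi2 : x * xi = 1 := hx.mul_val_inv
  obtain ⟨y, hy⟩ := exists_kerMap_eq_of_coef_eq_zero H (V := V) (x := xi * x' - 1) (by
    rw [map_sub, map_mul, hred, ← map_mul, hxi1, map_one, sub_self])
  have key : x' = x * (1 + (xi * x' - 1)) := by rw [add_sub_cancel, ← mul_assoc, hxi2, one_mul]
  refine ⟨y, ?_, fun y' hy' => ?_⟩
  · show x' = x * (1 + kerMap e (Sections f V) y)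
    rw [hy]; exact key
  have hy'' : x' = x * (1 + kerMap e (Sections f V) y') := hy'
  refine kerMap_sections_injective f e V ?_
  have h1 : x * (1 + kerMap e _ y') = x * (1 + kerMap e _ y) := by rw [← hy'', hy]; exact key
  exact add_left_cancel ((hx.mul_right_inj).1 h1)

include H hfl in
/-- **The difference cochain exists** for two unit cocycles over `R` with the same reduction along `π`, when the pairwise
intersections of the cover are affine and affine opens have flat sections: `u'_{ij} = u_{ij}(1 + κ η_{ij})` for all `i, j`
(∃ form of ★ `existsUnique_diffCochainK`). [cite: GortzWedhorn2023, Lemma 26.15]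
[cite: Hartshorne2010, §6 Thm. 6.4 (b) and proof (pp. 50–51)] -/
theorem exists_diffCochainK (hU2 : ∀ i j, IsAffineOpen (U i ⊓ U j)) (u u' : UCocycle f U R) (hred : SameRed u u' π) :
    ∃ η : Fin d → (i j : ι) → Sections f (U i ⊓ U j) ⊗[A] k,
      ∀ i j, u'.val i j = u.val i j * (1 + kerMap e _ (fun ℓ => η ℓ i j)) := by
  have hex : ∀ i j, ∃ y : Fin d → Sections f (U i ⊓ U j) ⊗[A] k, u'.val i j = u.val i j * (1 + kerMap e _ y) :=
    fun i j => by
      haveI := hfl _ (hU2 i j)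
      exact (existsUnique_diffK_flat H (u.isUnit i j) (hred i j)).exists
  choose y hy using hex
  exact ⟨fun ℓ i j => y i j ℓ, fun i j => hy i j⟩

include H hfl in
/-- **The difference cochain is unique** (same hypotheses). [cite: GortzWedhorn2023, Lemma 26.15] -/
theorem diffCochainK_unique (hU2 : ∀ i j, IsAffineOpen (U i ⊓ U j)) (u u' : UCocycle f U R) (hred : SameRed u u' π)
    (η η' : Fin d → (i j : ι) → Sections f (U i ⊓ U j) ⊗[A] k)
    (hη : ∀ i j, u'.val i j = u.val i j * (1 + kerMap e _ (fun ℓ => η ℓ i j)))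
    (hη' : ∀ i j, u'.val i j = u.val i j * (1 + kerMap e _ (fun ℓ => η' ℓ i j))) : η = η' := by
  funext ℓ i j
  haveI := hfl _ (hU2 i j)
  exact congrFun ((existsUnique_diffK_flat H (u.isUnit i j) (hred i j)).unique (hη i j) (hη' i j)) ℓ

include H hρ hfl in
/-- **A difference cochain is a `d`-tuple of Čech `1`-COCYCLES of the residue models** (`η_{jl}| − η_{il}| + η_{ij}| = 0` on
`U_i ∩ U_j ∩ U_l`), the triple intersections being affine (★ `diffCochainK_cocycle` with flatness on the cover only).
[cite: GortzWedhorn2023, Lemma 26.15] [cite: Hartshorne2010, §6 Thm. 6.4 (b) and proof (pp. 50–51)] -/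
theorem diffCochainK_cocycle_of_isAffineOpen (hU3 : ∀ i j l, IsAffineOpen (U i ⊓ U j ⊓ U l)) (u u' : UCocycle f U R)
    (η : Fin d → (i j : ι) → Sections f (U i ⊓ U j) ⊗[A] k)
    (hη : ∀ i j, u'.val i j = u.val i j * (1 + kerMap e _ (fun ℓ => η ℓ i j))) (ℓ : Fin d) (i j l : ι) :
    resR f k (le23 (U := U) i j l) (η ℓ j l) - resR f k (le13 (U := U) i j l) (η ℓ i l) +
      resR f k (le12 (U := U) i j l) (η ℓ i j) = 0 := by
  haveI := hfl _ (hU3 i j l)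
  have e12 := congrArg (resR f R (le12 (U := U) i j l)) (hη i j)
  have e23 := congrArg (resR f R (le23 (U := U) i j l)) (hη j l)
  have e13 := congrArg (resR f R (le13 (U := U) i j l)) (hη i l)
  simp only [map_mul, map_add, map_one, resR_kerMap] at e12 e23 e13
  have hc' := u'.cocycle i j l
  rw [e12, e23, e13] at hc'
  have hu13 : IsUnit (resR f R (le13 (U := U) i j l) (u.val i l)) := (u.isUnit i l).map _
  rw [mul_mul_mul_comm, u.cocycle, one_add_kerMap_mul H hρ] at hc'
  have h2 := add_left_cancel ((hu13.mul_right_inj).1 hc')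
  have h3 := congrFun (kerMap_sections_injective f e _ h2) ℓ
  simp only [Pi.add_apply] at h3
  rw [← h3]; ring

include H hρ hfl in
/-- **Cohomologous ⟹ coboundary** (★ `exists_eq_cechD0_of_rel` with flatness on the cover only): if `u'` is obtained from `u` by a
`0`-cochain `h` reducing to `1`, every difference cochain of `(u, u')` is a Čech coboundary of the residue models.
[cite: GortzWedhorn2023, Lemma 26.15] [cite: Hartshorne2010, §6 Thm. 6.4 (b) and proof (pp. 50–51)] -/
theorem exists_eq_cechD0_of_rel_of_isAffineOpen (hU2 : ∀ i j, IsAffineOpen (U i ⊓ U j)) (u u' : UCocycle f U R)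
    (h : (i : ι) → Sections f (U i) ⊗[A] R) (h1 : ∀ i, coef f π _ (h i) = 1) (hr : Rel u u' h)
    (η : Fin d → (i j : ι) → Sections f (U i ⊓ U j) ⊗[A] k)
    (hη : ∀ i j, u'.val i j = u.val i j * (1 + kerMap e _ (fun ℓ => η ℓ i j))) :
    ∃ β : Fin d → (i : ι) → Sections f (U i) ⊗[A] k, ∀ ℓ i j,
      η ℓ i j = resR f k (inf_le_right : U i ⊓ U j ≤ U j) (β ℓ j) - resR f k (inf_le_left : U i ⊓ U j ≤ U i) (β ℓ i) := by
  have hb : ∀ i, ∃ b : Fin d → Sections f (U i) ⊗[A] k, h i = 1 + kerMap e _ b := fun i => exists_eq_one_add_kerMap H (h1 i)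
  choose b hb using hb
  have hred : SameRed u u' π := sameRed_of_rel u u' h h1 hr
  refine ⟨fun ℓ i => -b i ℓ, fun ℓ i j => ?_⟩
  haveI := hfl _ (hU2 i j)
  set bi : Fin d → Sections f (U i ⊓ U j) ⊗[A] k := fun ℓ => resR f k (inf_le_left : U i ⊓ U j ≤ U i) (b i ℓ)
  set bj : Fin d → Sections f (U i ⊓ U j) ⊗[A] k := fun ℓ => resR f k (inf_le_right : U i ⊓ U j ≤ U j) (b j ℓ)
  have hij := hr i j
  rw [hb i, hb j] at hij
  simp only [map_add, map_one, resR_kerMap] at hij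
  have hinv : (1 + kerMap e _ bj) * (1 + kerMap e _ (-bj)) = 1 := by
    rw [one_add_kerMap_mul H hρ, add_neg_cancel, map_zero, add_zero]
  have hrel : u'.val i j = u.val i j * (1 + kerMap e _ (bi + -bj)) :=
    calc u'.val i j = u'.val i j * ((1 + kerMap e _ bj) * (1 + kerMap e _ (-bj))) := by rw [hinv, mul_one]
      _ = ((1 + kerMap e _ bi) * u.val i j) * (1 + kerMap e _ (-bj)) := by rw [← mul_assoc, ← hij]
      _ = u.val i j * ((1 + kerMap e _ bi) * (1 + kerMap e _ (-bj))) := by ring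
      _ = u.val i j * (1 + kerMap e _ (bi + -bj)) := by rw [one_add_kerMap_mul H hρ]
  have huniq := (existsUnique_diffK_flat H (u.isUnit i j) (hred i j)).unique (hη i j) hrel
  have hℓ := congrFun huniq ℓ
  simp only [Pi.add_apply, Pi.neg_apply, bi, bj] at hℓ
  rw [hℓ]; simp only [map_neg]; abel

end Diff

/-! ## §2 The class on the fibre with flatness on the cover only -/

section Fibre

variable {Z : Scheme.{u}} {fZ : Z ⟶ Spec (.of k)} {g : Z ⟶ X} (hg : g ≫ f = restrictBase A fZ)

include H hρ hfl in
/-- **A difference cochain read on the fibre `Z = X ×_A Spec k` is a Čech `1`-COCYCLE of `𝒪_Z` on `g⁻¹𝒰`** (★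
`bcSections_comm_mem_cechZ1` with flatness on the affine triple intersections only). [cite: GortzWedhorn2023, Lemma 26.15]
[cite: Hartshorne2010, §6 Thm. 6.4 (b) and proof (pp. 50–51)] -/
theorem fibreCochain_mem_cechZ1 (hU3 : ∀ i j l, IsAffineOpen (U i ⊓ U j ⊓ U l)) (u u' : UCocycle f U R)
    (η : Fin d → (i j : ι) → Sections f (U i ⊓ U j) ⊗[A] k)
    (hη : ∀ i j, u'.val i j = u.val i j * (1 + kerMap e _ (fun ℓ => η ℓ i j))) (ℓ : Fin d) :
    (fun i j => (bcSections f fZ g hg (pre2 g U i j)).comp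
        (Algebra.TensorProduct.comm A (Sections f (U i ⊓ U j)) k).toAlgHom (η ℓ i j) :
          CechC1 (restrictBase A fZ) (preimageFamily g U)) ∈
      cechZ1 (restrictBase A fZ) (preimageFamily g U) := by
  rw [mem_cechZ1_iff]
  funext i j l
  have e3 : preimageFamily g U i ⊓ preimageFamily g U j ⊓ preimageFamily g U l ≤ g ⁻¹ᵁ (U i ⊓ U j ⊓ U l) :=
    fun _ hx => hx
  have key := congrArg ((bcSections f fZ g hg e3).comp
    (Algebra.TensorProduct.comm A (Sections f (U i ⊓ U j ⊓ U l)) k).toAlgHom)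
    (diffCochainK_cocycle_of_isAffineOpen H hρ hfl hU3 u u' η hη ℓ i j l)
  rw [map_zero, map_add, map_sub] at key
  rw [cechD1_apply]
  change Sections.res (restrictBase A fZ) _ _ - Sections.res (restrictBase A fZ) _ _ + Sections.res (restrictBase A fZ) _ _ =
    (0 : CechC2 (restrictBase A fZ) (preimageFamily g U)) i j l
  rw [res_bcSections_comm hg _ e3 (le23 (U := U) i j l), res_bcSections_comm hg _ e3 (le13 (U := U) i j l),
    res_bcSections_comm hg _ e3 (le12 (U := U) i j l)]
  exact key

include H hρ hfl in
/-- **ZERO CLASS ON THE FIBRE ⟹ COHOMOLOGOUS LIFTS** for a cover by affine opens with affine pairwise and triple intersections and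
affine opens having flat sections (★ `exists_rel_of_fibreClass_eq_zero` re-cut): if every component of the difference cochain of
`(u, u')` read on the fibre has class `0` in `Ȟ¹(g⁻¹𝒰, 𝒪_Z)`, then `u'` is obtained from `u` by a unit `0`-cochain reducing to `1`
along `π`. [cite: Hartshorne2010, §6 Thm. 6.4 (b) and proof (pp. 50–51)] [cite: GortzWedhorn2023, Lemma 24.72 proof Step (I) (p. 409)] -/
theorem exists_rel_of_fibreClass_eq_zero_of_isAffineOpen
    (HP : IsPullback g fZ f (Spec.map (CommRingCat.ofHom (algebraMap A k))))
    (hU : ∀ i, IsAffineOpen (U i)) (hU2 : ∀ i j, IsAffineOpen (U i ⊓ U j)) (hU3 : ∀ i j l, IsAffineOpen (U i ⊓ U j ⊓ U l))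
    (u u' : UCocycle f U R) (η : Fin d → (i j : ι) → Sections f (U i ⊓ U j) ⊗[A] k)
    (hη : ∀ i j, u'.val i j = u.val i j * (1 + kerMap e _ (fun ℓ => η ℓ i j)))
    (h0 : ∀ ℓ, CechH1.mk (restrictBase A fZ) (preimageFamily g U)
      ⟨_, fibreCochain_mem_cechZ1 H hρ hfl HP.w hU3 u u' η hη ℓ⟩ = 0) :
    ∃ h : UCochain0 f U R, (∀ i, coef f π (U i) (h i : Sections f (U i) ⊗[A] R) = 1) ∧
      Rel u u' (fun i => (h i : Sections f (U i) ⊗[A] R)) := by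
  have hB : ∀ ℓ, ∃ γ : CechC0 (restrictBase A fZ) (preimageFamily g U),
      cechD0 (restrictBase A fZ) (preimageFamily g U) γ =
        fun i j => (bcSections f fZ g HP.w (pre2 g U i j)).comp
          (Algebra.TensorProduct.comm A (Sections f (U i ⊓ U j)) k).toAlgHom (η ℓ i j) := fun ℓ => by
    have h1 := (CechH1.mk_eq_zero_iff (restrictBase A fZ) (preimageFamily g U) _).1 (h0 ℓ)
    exact (mem_cechB1_iff (restrictBase A fZ) (preimageFamily g U) _).1 h1
  choose γ hγ using hB
  have hsurj : ∀ ℓ i, ∃ b : Sections f (U i) ⊗[A] k,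
      (bcSections f fZ g HP.w (le_refl (g ⁻¹ᵁ (U i)))).comp (Algebra.TensorProduct.comm A (Sections f (U i)) k).toAlgHom b =
        γ ℓ i := fun ℓ i => (bcSections_comm_bijective HP (hU i)).2 (γ ℓ i)
  choose β hβ using hsurj
  refine exists_rel_of_diffCochainK_eq_cechD0 H hρ u u' η hη β fun ℓ i j => ?_
  apply bcSections_comm_inf_injective HP i j (hU2 i j)
  have e1 := congrFun (congrFun (hγ ℓ) i) j
  rw [cechD0_apply] at e1
  change _ = ((bcSections f fZ g HP.w (pre2 g U i j)).comp (Algebra.TensorProduct.comm A (Sections f (U i ⊓ U j)) k).toAlgHom) _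
  rw [← e1, map_sub, ← hβ ℓ i, ← hβ ℓ j]
  rw [res_bcSections_comm HP.w (le_refl _) (pre2 g U i j) (inf_le_right : U i ⊓ U j ≤ U j),
    res_bcSections_comm HP.w (le_refl _) (pre2 g U i j) (inf_le_left : U i ⊓ U j ≤ U i)]

include H hρ hfl in
/-- **COHOMOLOGOUS LIFTS ⟹ ZERO CLASS ON THE FIBRE** (★ `fibreClass_eq_zero_of_rel` re-cut; pairwise and triple intersections
affine, affine opens with flat sections). [cite: Hartshorne2010, §6 Thm. 6.4 (b) and proof (pp. 50–51)]
[cite: GortzWedhorn2023, Lemma 26.15] -/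
theorem fibreClass_eq_zero_of_rel_of_isAffineOpen (hU2 : ∀ i j, IsAffineOpen (U i ⊓ U j))
    (hU3 : ∀ i j l, IsAffineOpen (U i ⊓ U j ⊓ U l)) (u u' : UCocycle f U R) (h : (i : ι) → Sections f (U i) ⊗[A] R)
    (h1 : ∀ i, coef f π _ (h i) = 1) (hr : Rel u u' h)
    (η : Fin d → (i j : ι) → Sections f (U i ⊓ U j) ⊗[A] k)
    (hη : ∀ i j, u'.val i j = u.val i j * (1 + kerMap e _ (fun ℓ => η ℓ i j))) (ℓ : Fin d) :
    CechH1.mk (restrictBase A fZ) (preimageFamily g U) ⟨_, fibreCochain_mem_cechZ1 H hρ hfl hg hU3 u u' η hη ℓ⟩ = 0 := by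
  obtain ⟨β, hβ⟩ := exists_eq_cechD0_of_rel_of_isAffineOpen H hρ hfl hU2 u u' h h1 hr η hη
  apply (CechH1.mk_eq_zero_iff (restrictBase A fZ) (preimageFamily g U) _).2
  refine (mem_cechB1_iff (restrictBase A fZ) (preimageFamily g U) _).2
    ⟨fun i => (bcSections f fZ g hg (le_refl (g ⁻¹ᵁ (U i)))).comp
      (Algebra.TensorProduct.comm A (Sections f (U i)) k).toAlgHom (β ℓ i), ?_⟩
  funext i j
  rw [cechD0_apply]
  change Sections.res (restrictBase A fZ) _ _ - Sections.res (restrictBase A fZ) _ _ =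
    (bcSections f fZ g hg (pre2 g U i j)).comp
      (Algebra.TensorProduct.comm A (Sections f (U i ⊓ U j)) k).toAlgHom (η ℓ i j)
  rw [res_bcSections_comm hg (le_refl _) (pre2 g U i j) (inf_le_right : U i ⊓ U j ≤ U j),
    res_bcSections_comm hg (le_refl _) (pre2 g U i j) (inf_le_left : U i ⊓ U j ≤ U i), ← map_sub,
    ← hβ ℓ i j]

end Fibre

/-! ## §3 THE FACE STEP with flatness on the covers only -/

section Face

variable {Y : Scheme.{u}} {fY : Y ⟶ Spec (.of A)} {jY : Y ⟶ X} (hj : jY ≫ f = fY)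
  (hflY : ∀ V : Y.Opens, IsAffineOpen V → Module.Flat A (Sections fY V))
  {Z W : Scheme.{u}} {fZ : Z ⟶ Spec (.of k)} {g : Z ⟶ X} (hg : g ≫ f = restrictBase A fZ)
  {fW : W ⟶ Spec (.of k)} {gW : W ⟶ Y} (hgW : gW ≫ fY = restrictBase A fW) {hW : W ⟶ Z} (hhW : hW ≫ fZ = fW)
  (hsq : hW ≫ g = gW ≫ jY)

include H hρ hfl hj hflY hgW hhW hsq in
/-- **THE FACE STEP** ([GortzWedhorn2023] Lemma 24.72 Step (I), ★ `cechComapH1_fibreClass_eq_zero_of_rel_comap` re-cut with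
flatness on the covers only): for a face `jY : Y → X` over `Spec A` with fibre square `hW ≫ g = gW ≫ jY`, if the restricted lifts
`u|_Y`, `u'|_Y` are cohomologous by a `0`-cochain reducing to `1` along `π`, then `hW^*[η^fibre_ℓ] = 0` in `Ȟ¹(hW⁻¹g⁻¹𝒰, 𝒪_W)`
for every component `ℓ` of a difference cochain `η` of `(u, u')`.  Hypotheses: the triple intersections of `𝒰` on `X` and the
pairwise and triple intersections of `jY⁻¹𝒰` on `Y` are affine, and affine opens of `X`, `Y` have `A`-flat sections.
[cite: GortzWedhorn2023, Lemma 24.72 proof Step (I) (p. 409)] [cite: Hartshorne2010, §6 Thm. 6.4 (b) and proof (pp. 50–51)] -/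
theorem cechComapH1_fibreClass_eq_zero_of_rel_comap_of_isAffineOpen
    (hU3 : ∀ i j l, IsAffineOpen (U i ⊓ U j ⊓ U l))
    (hUY2 : ∀ i j, IsAffineOpen (preimageFamily jY U i ⊓ preimageFamily jY U j))
    (hUY3 : ∀ i j l, IsAffineOpen (preimageFamily jY U i ⊓ preimageFamily jY U j ⊓ preimageFamily jY U l))
    (u u' : UCocycle f U R)
    (η : Fin d → (i j : ι) → Sections f (U i ⊓ U j) ⊗[A] k)
    (hη : ∀ i j, u'.val i j = u.val i j * (1 + kerMap e _ (fun ℓ => η ℓ i j)))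
    {uY u'Y : UCocycle fY (preimageFamily jY U) R}
    (huY : ∀ i j, uY.val i j = Algebra.TensorProduct.map (Sections.comap f fY jY hj (pre2 jY U i j)) (AlgHom.id A R) (u.val i j))
    (hu'Y : ∀ i j, u'Y.val i j =
      Algebra.TensorProduct.map (Sections.comap f fY jY hj (pre2 jY U i j)) (AlgHom.id A R) (u'.val i j))
    (h : (i : ι) → Sections fY (preimageFamily jY U i) ⊗[A] R) (h1 : ∀ i, coef fY π _ (h i) = 1) (hr : Rel uY u'Y h) (ℓ : Fin d) :
    cechComapH1 (restrictBase A fZ) (restrictBase A fW) hW (by rw [restrictBase, ← Category.assoc, hhW]) (preimageFamily g U)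
      (CechH1.mk (restrictBase A fZ) (preimageFamily g U) ⟨_, fibreCochain_mem_cechZ1 H hρ hfl hg hU3 u u' η hη ℓ⟩) = 0 := by
  -- the restricted difference cochain and its fibre class along `gW`
  have hηY := diffCochainK_comap hj huY hu'Y η hη
  have h0 := fibreClass_eq_zero_of_rel_of_isAffineOpen (hg := hgW) H hρ hflY hUY2 hUY3 uY u'Y h h1 hr _ hηY ℓ
  -- `hW^*[η^fibre] = [fibre cochain along hW ≫ g]`
  have hφ : (hW ≫ g) ≫ f = restrictBase A fW := by rw [Category.assoc, hg, restrictBase, ← Category.assoc, hhW]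
  have hφ' : (gW ≫ jY) ≫ f = restrictBase A fW := by rw [Category.assoc, hj, hgW]
  rw [cechComapH1_mk]
  have step1 : cechComapZ1 (restrictBase A fZ) (restrictBase A fW) hW (by rw [restrictBase, ← Category.assoc, hhW])
      (preimageFamily g U) ⟨_, fibreCochain_mem_cechZ1 H hρ hfl hg hU3 u u' η hη ℓ⟩ =
      ⟨_, fibreCochain_mem_cechZ1 H hρ hfl hφ hU3 u u' η hη ℓ⟩ := by
    apply Subtype.ext
    rw [cechComapZ1_coe]
    funext i j
    rw [cechComapC1_apply]
    exact comap_bcSections_comm hg hhW _ _ (η ℓ i j)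
  rw [step1]
  change CechH1.mk (restrictBase A fW) (preimageFamily (hW ≫ g) U) ⟨_, fibreCochain_mem_cechZ1 H hρ hfl hφ hU3 u u' η hη ℓ⟩ = 0
  rw [fibreClass_congr_eq_zero_iff hsq hφ hφ' η ℓ (fibreCochain_mem_cechZ1 H hρ hfl hφ hU3 u u' η hη ℓ)
    (fibreCochain_mem_cechZ1 H hρ hfl hφ' hU3 u u' η hη ℓ)]
  -- `[fibre cochain along gW ≫ jY of η] = [fibre cochain along gW of η|_Y] = 0`
  have step2 : CechH1.mk (restrictBase A fW) (preimageFamily (gW ≫ jY) U)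
      ⟨_, fibreCochain_mem_cechZ1 H hρ hfl hφ' hU3 u u' η hη ℓ⟩ =
      CechH1.mk (restrictBase A fW) (preimageFamily gW (preimageFamily jY U))
        ⟨_, fibreCochain_mem_cechZ1 H hρ hflY hgW hUY3 uY u'Y _ hηY ℓ⟩ := by
    congr 1
    apply Subtype.ext
    funext i j
    exact (bcSections_comm_comap hj hgW _ _ (η ℓ i j)).symm
  rw [step2]
  exact h0

end Face

end CechUnitCocycle

end Literature.AlgebraicGeometry.Morphisms

end
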